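import Summits.Langlands.Langlands.Theorems.PicardMuOrdinaryMuOrdinaryFamilyRTThornePolarizationTransport
import HarnessLib

/-!
# Crux `MuOrdinaryFamilyRT` (stmt-Langlands-13757), line `thorne-minimal-lift`: PA-I glue H1 = G5b of
# `stub_thorneInputOverL` — the polarization identity of a twisting character along the complex
# conjugations of `Γ_{F'⁺}` gives it along the complex conjugations of `Γ_ℚ`
# (`thetaPolarization_rat_of_maximalReal`, PROVED)

For a CM number field `F'` Galois over `ℚ` with maximal totally real subfield
`F'⁺ = NumberField.maximalRealSubfield F'`, a continuous character `θ : Γ_{F'} → ℚ̄₃ˣ` and `k ∈ ℤ`,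
the identity `θ(ᶜσ) · θ(σ) = ε(σ)^k` (`ε` the `3`-adic cyclotomic character) is moved from the outer
action `ᶜσ = absGaloisOuterConj F'⁺ F' c̃ σ` of the lifts `c̃ ∈ Γ_{F'⁺}` of `complexConj F'`
(`absGaloisQuot F'⁺ F' c̃ = complexConj F'`, the form produced by the twisting data of the line) to the
outer action `absGaloisOuterConj ℚ F' c σ` of the genuine complex conjugations `c ∈ Γ_ℚ`
(`IsComplexConjugation (algebraMap ℚ ℝ) c`, the form consumed by `TracePolarized` /
`tracePolarized_twist`).  Elementary Galois theory of the tower `ℚ ⊆ F'⁺ ⊆ F'`: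

* § 1 `mem_range_absGaloisRestrict_rat_of_isComplexConjugation`: a complex conjugation of `Γ_ℚ` lies
  in `res(Γ_M)` for every totally real `M` (it acts as `conj` under an embedding `ℚ̄ → ℂ`, and the copy
  `e(M) ⊂ ℚ̄` of `M` has real image; `mem_range_absGaloisRestrict_iff_smul_absEmbedding`);
* § 1 `absGaloisQuot_eq_complexConj_of_absGaloisRestrict_eq`: if `c̃ ∈ Γ_{L⁺}` restricts to a complex
  conjugation of `Γ_ℚ`, then `c̃` induces `complexConj L` on the CM field `L` (transport the embedding
  `ℚ̄ → ℂ` along the chosen `ℚ̄ ≅ \overline{L⁺}`, then Mathlib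
  `NumberField.IsCMField.complexEmbedding_complexConj` as in `absGaloisQuot_eq_complexConj`);
* § 2 the stub: the composite `Γ_{F'} → Γ_{F'⁺} → Γ_ℚ` is `Int(γ) ∘ res_ℚ^{F'}` for a fixed `γ ∈ Γ_ℚ`
  (`SorensenPatching.exists_absGaloisRestrict_absGaloisRestrict_eq_conj`); `γ c γ⁻¹` is a complex
  conjugation (`isComplexConjugation_conj`), hence `= res c̃` with `c̃ ∈ Γ_{F'⁺}` inducing
  `complexConj F'` (§ 1), and then `absGaloisOuterConj F'⁺ F' c̃ = absGaloisOuterConj ℚ F' c` on the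
  nose (compare images in `Γ_ℚ`; both restriction maps are injective), so the hypothesis at `c̃` is the
  conclusion at `c`.
-/

set_option linter.dupNamespace false -- `Summit.Langlands.Langlands.…` is the problem's namespace

namespace Summit.Langlands.Langlands.Cruxes.MuOrdinaryFamilyRT.ThorneMinimalLift

open scoped NumberField Polynomial Matrix Classical
open Field IsDedekindDomain Polynomial
open Literature.NumberTheory.GaloisRepresentations Literature.NumberTheory.Automorphic
open Summit.Langlands.Langlands.Cruxes.MuOrdinaryFamilyRT.CharZeroDominance

noncomputable section

/-! ## 1. Complex conjugations of `Γ_ℚ` and totally real / CM fields -/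

/-- **A complex conjugation of `Γ_ℚ` lies in `res(Γ_M)` for `M` totally real**: it acts as `conj`
under an embedding `i : ℚ̄ → ℂ` (`isComplexConjugation_iff`), and `i ∘ e : M → ℂ` is a real embedding
(`NumberField.IsTotallyReal.complexEmbedding_isReal`), so it fixes the copy `e(M)` of `M` in `ℚ̄`
pointwise, which is membership in `res(Γ_M)` (`mem_range_absGaloisRestrict_iff_smul_absEmbedding`). -/
theorem mem_range_absGaloisRestrict_rat_of_isComplexConjugation (M : Type*) [Field M] [NumberField M]
    [NumberField.IsTotallyReal M] {c : absoluteGaloisGroup ℚ}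
    (hc : IsComplexConjugation (algebraMap ℚ ℝ) c) : c ∈ (absGaloisRestrict ℚ M).range := by
  rw [mem_range_absGaloisRestrict_iff_smul_absEmbedding]
  obtain ⟨i, -, hic⟩ := isComplexConjugation_iff.mp hc
  intro x
  apply i.injective
  rw [hic]
  exact RingHom.congr_fun (NumberField.ComplexEmbedding.isReal_iff.mp
    (NumberField.IsTotallyReal.complexEmbedding_isReal (i.comp (absEmbedding ℚ M).toRingHom))) x

/-- **An element of `Γ_{L⁺}` restricting to a complex conjugation of `Γ_ℚ` induces `complexConj L` on
the CM field `L`.**  If `res_ℚ^{L⁺} c̃ = c` acts as `conj` under `i : ℚ̄ → ℂ`, then `c̃` acts as `conj`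
under `j = i ∘ ι⁻¹ : \overline{L⁺} → ℂ` (`ι = absClosureEquiv ℚ L⁺`, `ι (res c̃ • z) = c̃ • ι z`), so on
the copy `e(L)` of `L` (`absEmbedding L⁺ L`) it induces the conjugation of the complex embedding
`j ∘ e` of `L`, which is `complexConj L` (Mathlib `NumberField.IsCMField.complexEmbedding_complexConj`). -/
theorem absGaloisQuot_eq_complexConj_of_absGaloisRestrict_eq {L : Type*} [Field L] [NumberField L]
    [NumberField.IsCMField L] {c : absoluteGaloisGroup ℚ} (hc : IsComplexConjugation (algebraMap ℚ ℝ) c)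
    {c' : absoluteGaloisGroup (NumberField.maximalRealSubfield L)}
    (h : absGaloisRestrict ℚ (NumberField.maximalRealSubfield L) c' = c) :
    absGaloisQuot (NumberField.maximalRealSubfield L) L c' = NumberField.IsCMField.complexConj L := by
  obtain ⟨i, -, hic⟩ := isComplexConjugation_iff.mp hc
  let ιe := absClosureEquiv ℚ (NumberField.maximalRealSubfield L)
  let j : AlgebraicClosure (NumberField.maximalRealSubfield L) →+* ℂ := i.comp ιe.symm.toRingEquiv.toRingHom
  have hj : ∀ y, j (c' • y) = starRingEnd ℂ (j y) := fun y ↦ by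
    have hy : ιe.symm (c' • y) = c • ιe.symm y := by
      apply (absClosureEmbedding_bijective ℚ (NumberField.maximalRealSubfield L)).1
      rw [← h, absGaloisRestrict_apply_smul, ← absClosureEquiv_apply, ← absClosureEquiv_apply,
        ιe.apply_symm_apply, ιe.apply_symm_apply]
    change i (ιe.symm (c' • y)) = starRingEnd ℂ (i (ιe.symm y))
    rw [hy, hic]
  ext z
  let ψ : L →+* ℂ := j.comp (absEmbedding (NumberField.maximalRealSubfield L) L).toRingHom
  apply ψ.injective
  rw [NumberField.IsCMField.complexEmbedding_complexConj]
  change j (absEmbedding _ L (absGaloisQuot _ L c' z)) = starRingEnd ℂ (j (absEmbedding _ L z))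
  rw [absEmbedding_absGaloisQuot_apply, hj]

/-! ## 2. The stub: from the lifts `c̃ ∈ Γ_{F'⁺}` of `complexConj F'` to the complex conjugations of `Γ_ℚ` -/

/-- **PA-I glue H1 = G5b of `stub_thorneInputOverL` (registered stub
`thetaPolarization_rat_of_maximalReal`).**  For `F'` CM and Galois over `ℚ`, a continuous character
`θ : Γ_{F'} → ℚ̄₃ˣ` and `k ∈ ℤ`: if `θ(θ^{F'⁺,F'}_{c̃} σ) · θ(σ) = ε(σ)^k` for every lift `c̃ ∈ Γ_{F'⁺}` of
`complexConj F'` and every `σ ∈ Γ_{F'}`, then `θ(θ^{ℚ,F'}_c σ) · θ(σ) = ε(σ)^k` for every complex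
conjugation `c ∈ Γ_ℚ`.  Proof: `res_ℚ^{F'⁺} ∘ res_{F'⁺}^{F'} = Int(γ) ∘ res_ℚ^{F'}`
(`SorensenPatching.exists_absGaloisRestrict_absGaloisRestrict_eq_conj`); the complex conjugation
`γ c γ⁻¹` (`isComplexConjugation_conj`) is `res_ℚ^{F'⁺} c̃` with `c̃ ∈ Γ_{F'⁺}` (`F'⁺` totally real,
`mem_range_absGaloisRestrict_rat_of_isComplexConjugation`) inducing `complexConj F'`
(`absGaloisQuot_eq_complexConj_of_absGaloisRestrict_eq`), and `θ^{F'⁺,F'}_{c̃} = θ^{ℚ,F'}_c` (equal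
images in `Γ_ℚ`, `absGaloisRestrict_absGaloisOuterConj`, injectivity of the restriction maps). -/
theorem thetaPolarization_rat_of_maximalReal : ∀ (F' : Type) [Field F'] [NumberField F'] [IsGalois ℚ F'] [NumberField.IsCMField F'] (k : ℤ) (θ : absoluteGaloisGroup F' →ₜ* (PadicAlgCl 3)ˣ), (∀ c : absoluteGaloisGroup (NumberField.maximalRealSubfield F'), absGaloisQuot (NumberField.maximalRealSubfield F') F' c = NumberField.IsCMField.complexConj F' → ∀ σ : absoluteGaloisGroup F', ((θ (absGaloisOuterConj (NumberField.maximalRealSubfield F') F' c σ) : (PadicAlgCl 3)ˣ) : PadicAlgCl 3) * (θ σ : PadicAlgCl 3) = algebraMap ℤ_[3] (PadicAlgCl 3) (((GaloisRep.cyclotomicCharacter F' 3 σ) ^ k : ℤ_[3]ˣ) : ℤ_[3])) → ∀ c : absoluteGaloisGroup ℚ, IsComplexConjugation (algebraMap ℚ ℝ) c → ∀ σ : absoluteGaloisGroup F', ((θ (absGaloisOuterConj ℚ F' c σ) : (PadicAlgCl 3)ˣ) : PadicAlgCl 3) * (θ σ : PadicAlgCl 3) = algebraMap ℤ_[3] (PadicAlgCl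 3) (((GaloisRep.cyclotomicCharacter F' 3 σ) ^ k : ℤ_[3]ˣ) : ℤ_[3]) := by
  intro F' _ _ _ _ k θ hθ c hc σ
  -- the composite `Γ_{F'} → Γ_{F'⁺} → Γ_ℚ` is `Int(γ) ∘ res_ℚ^{F'}`
  obtain ⟨γ, hγ⟩ := SorensenPatching.exists_absGaloisRestrict_absGaloisRestrict_eq_conj ℚ
    (NumberField.maximalRealSubfield F') F'
  -- `γ c γ⁻¹ = res c̃` with `c̃ ∈ Γ_{F'⁺}` a lift of `complexConj F'`
  obtain ⟨c', hc'⟩ := mem_range_absGaloisRestrict_rat_of_isComplexConjugation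
    (NumberField.maximalRealSubfield F') (isComplexConjugation_conj hc γ)
  change absGaloisRestrict ℚ (NumberField.maximalRealSubfield F') c' = γ * c * γ⁻¹ at hc'
  have hquot := absGaloisQuot_eq_complexConj_of_absGaloisRestrict_eq (L := F')
    (isComplexConjugation_conj hc γ) hc'
  -- `θ^{F'⁺,F'}_{c̃} σ = θ^{ℚ,F'}_c σ`
  have key : absGaloisOuterConj (NumberField.maximalRealSubfield F') F' c' σ =
      absGaloisOuterConj ℚ F' c σ := by
    apply absGaloisRestrict_injective (NumberField.maximalRealSubfield F') F'
    apply absGaloisRestrict_injective ℚ (NumberField.maximalRealSubfield F')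
    rw [absGaloisRestrict_absGaloisOuterConj, map_mul, map_mul, map_inv, hc', hγ, hγ,
      absGaloisRestrict_absGaloisOuterConj]
    group
  have h := hθ c' hquot σ
  rwa [key] at h

end

end Summit.Langlands.Langlands.Cruxes.MuOrdinaryFamilyRT.ThorneMinimalLift
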